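import Literature.NumberTheory.NumberFields.NFIsoTest
import Literature.NumberTheory.NumberFields.NFIsoNormPolyFP
import Literature.NumberTheory.NumberFields.NFIsoLocalFactorsFP
import Literature.Computability.Complexity.IrreducibilityLLLHenselFP
import Literature.Computability.Complexity.IrreducibilityLLLPrimeSearchFP
import HarnessLib

/-!
# The isomorphism test for number fields runs in polynomial time (`CodeFP`), modulo two bricks

Support file for the discharge of the named fact
`Literature.NumberTheory.NumberFields.nfIso_mem_P` (number-field isomorphism is in `P`;
Landau 1985, A. K. Lenstra 1983 Thm. (3.7)). Machine side of `NFIsoTest.lean` in the typed `FP`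
algebra `CodeFP`: the degree test, the multiplier step, the core loop and the full test are
polynomial-time string functions on codes, assembled from the tree's bricks
(`IrreducibilityLLL*FP.lean`: `pnormC`, `trimC`, `henselLiftC`, `goodPrimeC`, `sqNormListC`,
`berlekampFactorC` through `localFactorsCapC`; `normPolyC`) by `map`/`any`/`findSome?`/`Option.map`
combinators — no fold, hence no accumulator estimate, in this file. All numeric parameters that
index loops (`D`, `j`, the prime `ℓ`, the exponent `k`) are unary, as they are polynomially bounded
in VALUE. Two bricks of the tree's `lll_monicIrreducible_mem_P` development that are not yet
available enter as HYPOTHESES, in the shapes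

* `hFR : CodeFP (pairE (pairE unE unE) (pairE L natE)) intE (fun t => firstRowSqNorm t.1.1 t.1.2 t.2.1 t.2.2)`
  (the first-row norm of the LLL-reduced factor lattice, `IrreducibilityLLLDecide.firstRowSqNorm`),
* `hIrr : CodeFP L bitE irredTest` (the irreducibility test, `IrreducibilityLLLDecide.irredTest`),

and the file proves `testBoundC`, `degPrecisionC`, `degPrecisionExpC`, `degTestWithC_of hFR`,
`multStepC_of hFR`, `nfIsoCoreC_of hFR` and **`nfIsoTestC_of hIrr hFR`**:
`CodeFP (pairE L L) bitE (fun t => nfIsoTest t.1 t.2)`.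

## References

* S. Arora, B. Barak, *Computational Complexity: A Modern Approach*, CUP 2009, §1.3. [AroraBarak2009]
* S. Landau, SIAM J. Comput. 14 (1985), §2 (Thm. 2.1, Cor.). [Landau1985]
* A. K. Lenstra, H. W. Lenstra Jr., L. Lovász, Math. Ann. 261 (1982), §3. [LenstraLenstraLovasz1982]
-/

open Polynomial

namespace Literature.NumberTheory.NumberFields

open Literature.Computability.Complexity Literature.Computability.Complexity.CodeFP
open Literature.Computability.Complexity.SumcheckMA Literature.Computability.Complexity.LLLFactoring
open Literature.Algebra.EuclideanLattices

/-- The encoder of coefficient lists. -/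
local notation "L" => rawE intE

/-! ### The thresholds on codes -/

/-- **`testBound n S` on codes** (`n` unary). [cite: LenstraLenstraLovasz1982, (3.5)] [cite: AroraBarak2009, §1.3] -/
theorem testBoundC : CodeFP (pairE unE intE) intE (fun t => testBound t.1 t.2) := by
  have h2 : CodeFP (pairE unE intE) intE (fun t => (2 : ℤ) ^ (t.1 - [()].length)) :=
    (intPow.comp ((const _ (2 : ℤ)).pair ((unSubLen unitE).comp ((fst _ _).pair (const _ [()])))) :)
  have hn : CodeFP (pairE unE intE) intE (fun t => ((id t.1 : ℕ) : ℤ)) := (intOfNat.comp (natOfUn.comp (fst _ _)) :)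
  have h4 : CodeFP (pairE unE intE) intE (fun t => (4 : ℤ) ^ t.1) := (intPow.comp ((const _ (4 : ℤ)).pair (fst _ _)) :)
  exact (intMul.comp (h2.pair (intMul.comp ((intMul.comp (hn.pair h4)).pair (snd _ _))))).congr fun t => by
    simp [testBound]

/-- **`degPrecision D j S` on codes** (`D`, `j` unary). [cite: LenstraLenstraLovasz1982, (3.3)] [cite: AroraBarak2009, §1.3] -/
theorem degPrecisionC : CodeFP (pairE (pairE unE unE) intE) intE (fun t => degPrecision t.1.1 t.1.2 t.2) := by
  have hS : CodeFP (pairE (pairE unE unE) intE) intE (fun t => t.2) := snd _ _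
  have hD : CodeFP (pairE (pairE unE unE) intE) unE (fun t => t.1.1) := (fst _ _).fst'
  have hj : CodeFP (pairE (pairE unE unE) intE) unE (fun t => t.1.2) := (fst _ _).snd'
  exact (intMul.comp ((intPow.comp (hS.pair hj)).pair (intPow.comp ((testBoundC.comp ((unSucc.comp hj).pair hS)).pair hD)))).congr
    fun _ => rfl

/-- **`degPrecisionExp D j S` on codes**, in unary (it is a bit length). [cite: LenstraLenstraLovasz1982, (3.3)] [cite: AroraBarak2009, §1.3] -/
theorem degPrecisionExpC : CodeFP (pairE (pairE unE unE) intE) unE (fun t => degPrecisionExp t.1.1 t.1.2 t.2) :=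
  (unSucc.comp (Khot.unSize.comp (intToNat.comp degPrecisionC))).congr fun _ => rfl

/-! ### The degree test on codes -/

/-- **The degree test on codes**, given the first-row brick: `((Nt, 1^D), (1^j, 1^ℓ)) ↦
degTestWith Nt D j ℓ⁺` (`ℓ⁺ = max ℓ 2`; an `any` over the capped local factors).
[cite: LenstraLenstraLovasz1982, (3.1)–(3.5)] [cite: AroraBarak2009, §1.3] -/
theorem degTestWithC_of
    (hFR : CodeFP (pairE (pairE unE unE) (pairE L natE)) intE (fun t => firstRowSqNorm t.1.1 t.1.2 t.2.1 t.2.2)) :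
    CodeFP (pairE (pairE L unE) (pairE unE unE)) bitE (fun t => degTestWith t.1.1 t.1.2 t.2.1 (max t.2.2 2)) := by
  -- the context `t = ((Nt, D), (j, ℓ))` with item `u`
  have hNt : CodeFP (pairE (pairE (pairE L unE) (pairE unE unE)) L) L (fun q => q.1.1.1) := (fst _ _).fst'.fst'
  have hD : CodeFP (pairE (pairE (pairE L unE) (pairE unE unE)) L) unE (fun q => q.1.1.2) := (fst _ _).fst'.snd'
  have hj : CodeFP (pairE (pairE (pairE L unE) (pairE unE unE)) L) unE (fun q => q.1.2.1) := (fst _ _).snd'.fst'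
  have hl : CodeFP (pairE (pairE (pairE L unE) (pairE unE unE)) L) unE (fun q => q.1.2.2) := (fst _ _).snd'.snd'
  have hu : CodeFP (pairE (pairE (pairE L unE) (pairE unE unE)) L) L (fun q => q.2) := snd _ _
  have hP : CodeFP (pairE (pairE (pairE L unE) (pairE unE unE)) L) natE (fun q => max q.1.2.2 2) := (maxTwoUnC.comp hl :)
  have hS : CodeFP (pairE (pairE (pairE L unE) (pairE unE unE)) L) intE (fun q => (sqNormList q.1.1.1 : ℤ)) :=
    (intOfNat.comp (sqNormListC.comp hNt) :)
  have hk : CodeFP (pairE (pairE (pairE L unE) (pairE unE unE)) L) unE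
      (fun q => degPrecisionExp q.1.1.2 q.1.2.1 (sqNormList q.1.1.1 : ℤ)) := (degPrecisionExpC.comp ((hD.pair hj).pair hS) :)
  have hd : CodeFP (pairE (pairE (pairE L unE) (pairE unE unE)) L) unE (fun q => q.2.length - 1) := (predLengthU.comp hu :)
  have hc1 : CodeFP (pairE (pairE (pairE L unE) (pairE unE unE)) L) bitE (fun q => decide (q.2.length - 1 ≤ q.1.2.1)) :=
    (natLe.comp ((natOfUn.comp hd).pair (natOfUn.comp hj))).congr fun _ => rfl
  have hU : CodeFP (pairE (pairE (pairE L unE) (pairE unE unE)) L) L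
      (fun q => henselLift (max q.1.2.2 2) (degPrecisionExp q.1.1.2 q.1.2.1 (sqNormList q.1.1.1 : ℤ)) q.1.1.1 q.2) :=
    (henselLiftC.comp (hl.pair (hk.pair (hNt.pair hu))) :)
  have hm : CodeFP (pairE (pairE (pairE L unE) (pairE unE unE)) L) natE
      (fun q => (max q.1.2.2 2) ^ degPrecisionExp q.1.1.2 q.1.2.1 (sqNormList q.1.1.1 : ℤ)) := (natPow.comp (hP.pair hk) :)
  have hfr : CodeFP (pairE (pairE (pairE L unE) (pairE unE unE)) L) intE
      (fun q => firstRowSqNorm (q.1.2.1 + 1) (q.2.length - 1)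
        (henselLift (max q.1.2.2 2) (degPrecisionExp q.1.1.2 q.1.2.1 (sqNormList q.1.1.1 : ℤ)) q.1.1.1 q.2)
        ((max q.1.2.2 2) ^ degPrecisionExp q.1.1.2 q.1.2.1 (sqNormList q.1.1.1 : ℤ))) :=
    (hFR.comp (((unSucc.comp hj).pair hd).pair (hU.pair hm)) :)
  have hT : CodeFP (pairE (pairE (pairE L unE) (pairE unE unE)) L) intE (fun q => testBound (q.1.2.1 + 1) (sqNormList q.1.1.1 : ℤ)) :=
    (testBoundC.comp ((unSucc.comp hj).pair hS) :)
  have hc2 := (intLe.comp (hfr.pair hT) :)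
  have hpred := hc1.and hc2
  -- the list of local factors, from the context
  have hfac : CodeFP (pairE (pairE L unE) (pairE unE unE)) (rawE L)
      (fun t => localFactorsCap (max t.2.2 2) (pnorm (max t.2.2 2) t.1.1)) :=
    (localFactorsCapC.comp ((snd _ _).snd'.pair (pnormC.comp ((maxTwoUnC.comp (snd _ _).snd').pair (fst _ _).fst'))) :)
  exact ((any hpred).comp ((CodeFP.id _).pair hfac)).congr fun t => rfl

/-! ### The multiplier step and the core loop on codes -/

/-- The multiplier step in the shape the machine computes it: the bricks work modulo `ℓ⁺ = max ℓ 2`.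
[cite: Cohen1993, Alg. 3.6.4] -/
noncomputable def multStepP (f g : List ℤ) (m n c : ℕ) : Option Bool :=
  (goodPrime (trim (normPoly f g (c : ℤ) m n))).map fun ℓ =>
    degTestWith (trim (normPoly f g (c : ℤ) m n)) (n * m) m (max ℓ 2)

/-- `multStepP = multStep`: the prime returned by `goodPrime` is `≥ 2`, so `ℓ⁺ = ℓ`. [folklore] -/
theorem multStepP_eq (f g : List ℤ) (m n c : ℕ) : multStepP f g m n c = multStep f g m n c := by
  rw [multStepP, multStep]
  exact Option.map_congr fun ℓ hℓ => by rw [max_eq_left (goodPrime_some (Option.mem_def.1 hℓ)).1.two_le]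

set_option maxHeartbeats 1600000 in
/-- **One multiplier on codes**, given the first-row brick: `((f, g), ((1^m, 1^n), c)) ↦ multStep f g m n c`.
[cite: Cohen1993, Alg. 3.6.4] [cite: AroraBarak2009, §1.3] -/
theorem multStepC_of
    (hFR : CodeFP (pairE (pairE unE unE) (pairE L natE)) intE (fun t => firstRowSqNorm t.1.1 t.1.2 t.2.1 t.2.2)) :
    CodeFP (pairE (pairE L L) (pairE (pairE unE unE) natE)) (optE bitE) (fun t => multStep t.1.1 t.1.2 t.2.1.1 t.2.1.2 t.2.2) := by
  have hf : CodeFP (pairE (pairE L L) (pairE (pairE unE unE) natE)) L (fun t => t.1.1) := (fst _ _).fst'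
  have hg : CodeFP (pairE (pairE L L) (pairE (pairE unE unE) natE)) L (fun t => t.1.2) := (fst _ _).snd'
  have hm : CodeFP (pairE (pairE L L) (pairE (pairE unE unE) natE)) unE (fun t => t.2.1.1) := (snd _ _).fst'.fst'
  have hn : CodeFP (pairE (pairE L L) (pairE (pairE unE unE) natE)) unE (fun t => t.2.1.2) := (snd _ _).fst'.snd'
  have hc : CodeFP (pairE (pairE L L) (pairE (pairE unE unE) natE)) intE (fun t => (t.2.2 : ℤ)) := (intOfNat.comp (snd _ _).snd' :)
  have hNt : CodeFP (pairE (pairE L L) (pairE (pairE unE unE) natE)) L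
      (fun t => trim (normPoly t.1.1 t.1.2 (t.2.2 : ℤ) t.2.1.1 t.2.1.2)) :=
    (trimC.comp (normPolyC.comp ((hf.pair hg).pair (hc.pair (hm.pair hn)))) :)
  have hD : CodeFP (pairE (pairE L L) (pairE (pairE unE unE) natE)) unE (fun t => t.2.1.2 * t.2.1.1) := (unMulC.comp (hm.pair hn) :)
  have hgp : CodeFP (pairE (pairE L L) (pairE (pairE unE unE) natE)) (optE unE)
      (fun t => goodPrime (trim (normPoly t.1.1 t.1.2 (t.2.2 : ℤ) t.2.1.1 t.2.1.2))) := (goodPrimeC.comp hNt :)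
  -- the degree test in the context `t`, item the prime `ℓ`
  have hNt' : CodeFP (pairE (pairE (pairE L L) (pairE (pairE unE unE) natE)) unE) L
      (fun q => trim (normPoly q.1.1.1 q.1.1.2 (q.1.2.2 : ℤ) q.1.2.1.1 q.1.2.1.2)) := (hNt.comp (fst _ _) :)
  have hD' : CodeFP (pairE (pairE (pairE L L) (pairE (pairE unE unE) natE)) unE) unE (fun q => q.1.2.1.2 * q.1.2.1.1) :=
    (hD.comp (fst _ _) :)
  have hm' : CodeFP (pairE (pairE (pairE L L) (pairE (pairE unE unE) natE)) unE) unE (fun q => q.1.2.1.1) := (hm.comp (fst _ _) :)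
  have hl : CodeFP (pairE (pairE (pairE L L) (pairE (pairE unE unE) natE)) unE) unE (fun q => q.2) := snd _ _
  have hsome : CodeFP (pairE (pairE (pairE L L) (pairE (pairE unE unE) natE)) unE) bitE
      (fun q => degTestWith (trim (normPoly q.1.1.1 q.1.1.2 (q.1.2.2 : ℤ) q.1.2.1.1 q.1.2.1.2)) (q.1.2.1.2 * q.1.2.1.1)
        q.1.2.1.1 (max q.2 2)) :=
    ((degTestWithC_of hFR).comp ((hNt'.pair hD').pair (hm'.pair hl)) :)
  have hP : CodeFP (pairE (pairE L L) (pairE (pairE unE unE) natE)) (optE bitE)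
      (fun t => multStepP t.1.1 t.1.2 t.2.1.1 t.2.1.2 t.2.2) :=
    ((optMap hsome).comp ((CodeFP.id _).pair hgp) :)
  exact hP.congr fun t => multStepP_eq _ _ _ _ _

/-- **The core loop on codes**, given the first-row brick: `(f, g) ↦ nfIsoCore f g`.
[cite: Landau1985, §2] [cite: Cohen1993, §4.5.4] [cite: AroraBarak2009, §1.3] -/
theorem nfIsoCoreC_of
    (hFR : CodeFP (pairE (pairE unE unE) (pairE L natE)) intE (fun t => firstRowSqNorm t.1.1 t.1.2 t.2.1 t.2.2)) :
    CodeFP (pairE L L) bitE (fun t => nfIsoCore t.1 t.2) := by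
  have hlf : CodeFP (pairE L L) unE (fun t => t.1.length) := ((ulength intE).comp (fst _ _) :)
  have hlg : CodeFP (pairE L L) unE (fun t => t.2.length) := ((ulength intE).comp (snd _ _) :)
  have htest : CodeFP (pairE L L) bitE (fun t => !decide (t.1.length = t.2.length)) :=
    ((natEq.comp ((natOfUn.comp hlf).pair (natOfUn.comp hlg))).not).congr fun _ => rfl
  have hn : CodeFP (pairE L L) unE (fun t => t.1.length - 1) := (predLengthU.comp (fst _ _) :)
  have hm : CodeFP (pairE L L) unE (fun t => t.2.length - 1) := (predLengthU.comp (snd _ _) :)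
  have hnm : CodeFP (pairE L L) unE (fun t => (t.1.length - 1) * (t.2.length - 1)) := (unMulC.comp (hm.pair hn) :)
  have hrange : CodeFP (pairE L L) (rawE natE)
      (fun t => List.range ((t.1.length - 1) * (t.2.length - 1) * ((t.1.length - 1) * (t.2.length - 1)) + 1)) :=
    (urange.comp (unSucc.comp (unMulC.comp (hnm.pair hnm))) :)
  have hstep : CodeFP (pairE (pairE L L) natE) (optE bitE) (fun q => multStep q.1.1 q.1.2 (q.1.2.length - 1) (q.1.1.length - 1) q.2) :=
    ((multStepC_of hFR).comp ((fst _ _).pair (((hm.comp (fst _ _)).pair (hn.comp (fst _ _))).pair (snd _ _))) :)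
  have hfind : CodeFP (pairE L L) (optE bitE)
      (fun t => (List.range ((t.1.length - 1) * (t.2.length - 1) * ((t.1.length - 1) * (t.2.length - 1)) + 1)).findSome?
        fun c => multStep t.1 t.2 (t.2.length - 1) (t.1.length - 1) c) :=
    ((findSomeFP hstep).comp ((CodeFP.id _).pair hrange) :)
  have hget : CodeFP (pairE (pairE L L) (optE bitE)) bitE (fun q => q.2.getD false) :=
    optCases (k := fun (_ : List ℤ × List ℤ) (o : Option Bool) => o.getD false) (const _ false) (snd _ _)
      (fun _ => rfl) (fun _ _ => rfl)
  have hcore : CodeFP (pairE L L) bitE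
      (fun t => ((List.range ((t.1.length - 1) * (t.2.length - 1) * ((t.1.length - 1) * (t.2.length - 1)) + 1)).findSome?
        fun c => multStep t.1 t.2 (t.2.length - 1) (t.1.length - 1) c).getD false) :=
    (hget.comp ((CodeFP.id _).pair hfind) :)
  refine ((htest.ite (const _ false) hcore).congr fun t => ?_)
  obtain ⟨f, g⟩ := t
  rw [nfIsoCore, sq]
  by_cases h : f.length = g.length
  · simp [h]
  · simp [h]

/-- **The isomorphism test for number fields on codes**, given the irreducibility test and the
first-row brick on codes: `(a, b) ↦ nfIsoTest a b` is computed by a polynomial-time string function.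
[cite: Landau1985, §2 (Cor.)] [cite: Lenstra1983, Thm. 3.7] [cite: AroraBarak2009, §1.3] -/
theorem nfIsoTestC_of (hIrr : CodeFP L bitE irredTest)
    (hFR : CodeFP (pairE (pairE unE unE) (pairE L natE)) intE (fun t => firstRowSqNorm t.1.1 t.1.2 t.2.1 t.2.2)) :
    CodeFP (pairE L L) bitE (fun t => nfIsoTest t.1 t.2) :=
  (((hIrr.comp (fst _ _)).and (hIrr.comp (snd _ _))).and
    ((nfIsoCoreC_of hFR).comp ((trimC.comp (fst _ _)).pair (trimC.comp (snd _ _))))).congr fun _ => rfl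

end Literature.NumberTheory.NumberFields
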